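import Literature.AlgebraicGeometry.Resolution.WeightedCentreClassLinearPin
import Literature.AlgebraicGeometry.Resolution.WeightedCentreVertexStep
import Literature.AlgebraicGeometry.Resolution.WeightedCentreLeadingForm
import Literature.AlgebraicGeometry.Resolution.WeightedCentrePolyShift
import Literature.AlgebraicGeometry.Resolution.WeightedCentreHeavyTaylor
import HarnessLib

/-!
# LEMMA L: a line of rigid translations fixing `G` unpins the lightest class it moves
# (instrument for engine 1's `W(f)` toy model, NOT a resolution theorem)

Engine 1 of the RESOLUTION OBSERVATORY toy model `W(f)` (RE-DERIVATION-eng1-g41 §3.7.3 LEMMA L, the heart of THEOREM RZ §3.7.4;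
CARVER-NOTES-eng1-g42 T92).  Setting: `G ∈ K[ε]` on slots `ι`; a set `Z` of PARAMETER slots carrying a non-negative "Z-weight"
`ω` (`ω > 0` exactly on `Z`); a RIGID direction field `v = (v_j)_j` — every `v_j ∈ K[ε_Z]`, `v = 0` on `Z` — all of whose blocks
weigh `≥ d`; and the line of translations along `v` fixes `G`: `G(ε + t·v) = G(ε)` in `K[ε][t]` (`PolyShift.polyShift v G = C G`;
by `WeightedCentreShiftLine` this IS the statement "`(v_j σ^r)_j` is a fixing shift").  LEMMA L: the `Z`-free part `Ḡ = G|_{ε_Z = 0}`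
has a non-zero CONSTANT invariant direction supported on the slots moved at `Z`-weight exactly `d`; so if those slots lie in one weight
class `S` whose face `G|_{≥ w_S}` is class-pinned, there is no block of weight `d` — and, taking `d` minimal, `v = 0`.

The proof is the engine's, in three typed steps:
1. `LemmaL.polyShift_leading_eq_C` — GRADED REDUCTION (any commutative `K`): weight `t` by `−d`; the leading-form principle
   (`LeadingForm.weightedHomogeneousComponent_aeval_of_wtGE` of `WeightedCentreLeadingForm`, in the `Option`-world of
   `WeightedCentreVertexStep`) gives `Ḡ(ε + t·v^{(d)}) = Ḡ`, `v^{(d)}` the weight-`d` blocks, `Ḡ` the `ω`-weight-`0` part of `G`;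
2. `LemmaL.exists_weight_unique_top` — the LEX-LEADING VERTEX, Mathlib-only: finitely many exponents supported in `Z` are separated by
   an integer weight on `Z` (base-`N` digits, `finFunctionFinEquiv`), so one of them, `γ₀`, is the unique top; then
   `VertexStep.isInvariantDir_of_vertex` (`K` a domain) makes the `γ₀`-coefficient vector `θ` of `v^{(d)}` an invariant direction of `Ḡ`:
   `LemmaL.exists_isInvariantDir`;
3. `LemmaL.isInvariantDir_killLight` / `killLight_weightedHomogeneousComponent_zero` — an invariant direction supported in the heavy
   slots passes to the face `killLight H` (`WeightedCentreHeavyTaylor`), and `Ḡ` and `G` have the same face when heavy slots are `Z`-free;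
   with `InvariantDirection.ClassPinned` (`WeightedCentreClassLinearPin`) this is the contradiction: `LemmaL.component_eq_zero_of_classPinned`
   (no block of weight `d` under the pin at the class of the weight-`d` slots) and the packaged **LEMMA L** `LemmaL.eq_zero_of_classPinned`
   (homogeneous blocks, equal block weight ⇒ equal class, `Z` lighter than every moved slot, every moved class pinned ⇒ `v = 0`).

References: Taylor expansion along a line, leading forms, algebraic independence [Lang2002, Ch. IV §1, Ch. XIII §4]; graded leading
forms [Matsumura1987, §27 (p. 207)]; the weighted frame [AbramovichTemkinWlodarczyk2024, §5.1 (p. 1575), Thm. 5.3.1].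
All statements are OURS (toy-model bookkeeping) — instruments for engine 1's `W(f)` model, NOT resolution theorems.
-/

namespace Literature.AlgebraicGeometry.Resolution.WeightedBlowup

namespace LemmaL

open MvPolynomial InvariantDirection

/-! ## 1. An integer weight with a unique top exponent (the lex-leading vertex, via base-`N` digits) -/

section SeparatingWeight

variable {ι : Type*} [DecidableEq ι]

/-- **Digits separate exponents** (ours, Mathlib-only): finitely many exponent vectors supported in a finite set `Z` are separated by a
natural-number weight supported in `Z` — weigh the `k`-th slot of `Z` by `N^k` with `N` larger than every exponent and read the weight as
a base-`N` expansion (`finFunctionFinEquiv`). [cite: Lang2002, Ch. IV §1] -/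
theorem exists_weight_injOn (Z : Finset ι) (Γ : Finset (ι →₀ ℕ)) (hZ : ∀ γ ∈ Γ, γ.support ⊆ Z) :
    ∃ ω : ι → ℕ, (∀ i, i ∉ Z → ω i = 0) ∧ Set.InjOn (Finsupp.weight ω : (ι →₀ ℕ) → ℕ) (Γ : Set (ι →₀ ℕ)) := by
  set N : ℕ := Γ.sup (fun γ => γ.support.sup γ) + 1 with hN
  have hlt : ∀ γ ∈ Γ, ∀ i, γ i < N := by
    intro γ hγ i
    have h1 : γ i ≤ γ.support.sup γ := by
      by_cases hi : i ∈ γ.support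
      · exact Finset.le_sup hi
      · rw [Finsupp.notMem_support_iff.mp hi]
        exact Nat.zero_le _
    have h2 : γ.support.sup γ ≤ Γ.sup (fun γ => γ.support.sup γ) :=
      Finset.le_sup (f := fun γ : ι →₀ ℕ => γ.support.sup γ) hγ
    omega
  have hN0 : 0 < N := by omega
  let e := Z.equivFin
  let ω : ι → ℕ := fun i => if h : i ∈ Z then N ^ (e ⟨i, h⟩ : ℕ) else 0
  let enc : (ι →₀ ℕ) → (Fin Z.card → Fin N) := fun γ k => ⟨γ (e.symm k) % N, Nat.mod_lt _ hN0⟩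
  have hw : ∀ γ ∈ Γ, Finsupp.weight ω γ = (finFunctionFinEquiv (enc γ) : ℕ) := by
    intro γ hγ
    rw [finFunctionFinEquiv_apply, Finsupp.weight_apply, Finsupp.sum,
      Finset.sum_subset (hZ γ hγ) (fun i _ hi => by rw [Finsupp.notMem_support_iff.mp hi, zero_smul]),
      ← Finset.sum_coe_sort Z]
    refine Fintype.sum_equiv e (fun i : Z => γ i • ω i) (fun k => (enc γ k : ℕ) * N ^ (k : ℕ)) fun i => ?_
    simp only [ω, enc, dif_pos i.2, smul_eq_mul, Equiv.symm_apply_apply, Nat.mod_eq_of_lt (hlt γ hγ _)]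
  refine ⟨ω, fun i hi => by simp only [ω, dif_neg hi], fun γ hγ γ' hγ' hww => ?_⟩
  have henc : enc γ = enc γ' := by
    apply finFunctionFinEquiv.injective
    apply Fin.ext
    rw [← hw γ hγ, ← hw γ' hγ']
    exact hww
  ext i
  by_cases hi : i ∈ Z
  · have h := congrFun henc (e ⟨i, hi⟩)
    simp only [enc, Fin.mk.injEq, Equiv.symm_apply_apply] at h
    rwa [Nat.mod_eq_of_lt (hlt γ hγ i), Nat.mod_eq_of_lt (hlt γ' hγ' i)] at h
  · rw [Finsupp.notMem_support_iff.mp fun h => hi (hZ γ hγ h), Finsupp.notMem_support_iff.mp fun h => hi (hZ γ' hγ' h)]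

/-- **A unique top exponent** (ours, Mathlib-only; the engine's "`γ₀` lexicographically maximal"): for a non-empty finite set of exponents
supported in `Z` there are an INTEGER weight supported in `Z` and a member `γ₀` strictly heavier than every other member.
[cite: Lang2002, Ch. IV §1] -/
theorem exists_weight_unique_top (Z : Finset ι) (Γ : Finset (ι →₀ ℕ)) (hΓ : Γ.Nonempty) (hZ : ∀ γ ∈ Γ, γ.support ⊆ Z) :
    ∃ ω : ι → ℤ, (∀ i, i ∉ Z → ω i = 0) ∧
      ∃ γ₀ ∈ Γ, ∀ γ ∈ Γ, γ ≠ γ₀ → Finsupp.weight ω γ < Finsupp.weight ω γ₀ := by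
  obtain ⟨ωN, hωZ, hinj⟩ := exists_weight_injOn Z Γ hZ
  obtain ⟨γ₀, hγ₀, hmax⟩ := Finset.exists_max_image Γ (Finsupp.weight ωN) hΓ
  have hcast : ∀ γ : ι →₀ ℕ, Finsupp.weight (fun i => (ωN i : ℤ)) γ = ((Finsupp.weight ωN γ : ℕ) : ℤ) := by
    intro γ
    rw [Finsupp.weight_apply, Finsupp.weight_apply, Finsupp.sum, Finsupp.sum, Nat.cast_sum]
    refine Finset.sum_congr rfl fun i _ => ?_
    rw [smul_eq_mul, nsmul_eq_mul, Nat.cast_mul]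
  refine ⟨fun i => (ωN i : ℤ), fun i hi => by simp only [hωZ i hi, Nat.cast_zero], γ₀, hγ₀, fun γ hγ hne => ?_⟩
  rw [hcast, hcast, Nat.cast_lt]
  exact lt_of_le_of_ne (hmax γ hγ) fun h => hne (hinj hγ hγ₀ h)

end SeparatingWeight

/-! ## 2. The graded reduction `G(ε + t·v) = G ⇒ Ḡ(ε + t·v^{lead}) = Ḡ` (any commutative `K`) -/

section Reduction

variable {K : Type*} [CommRing K] {ι : Type*} {M : Type*} [AddCommGroup M] [LinearOrder M] [IsOrderedAddMonoid M]

omit [LinearOrder M] [IsOrderedAddMonoid M] in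
/-- Transport of weighted homogeneity along `rename some` when the new weight extends the old one (ours, bookkeeping).
[cite: Lang2002, Ch. IV §1] -/
theorem isWeightedHomogeneous_rename_some {wt : Option ι → M} {ω : ι → M} (hcomp : wt ∘ some = ω)
    {f : MvPolynomial ι K} {n : M} (hf : IsWeightedHomogeneous ω f n) :
    IsWeightedHomogeneous wt (rename some f) n := by
  classical
  intro d hd
  have hd' : d ∈ (rename some f).support := mem_support_iff.mpr hd
  rw [support_rename_of_injective (Option.some_injective ι)] at hd'
  obtain ⟨m, hm, rfl⟩ := Finset.mem_image.mp hd'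
  rw [VertexStep.weight_mapDomain, hcomp]
  exact hf (mem_support_iff.mp hm)

omit [IsOrderedAddMonoid M] in
/-- Transport of strict lower weight bounds along `rename some` (ours, bookkeeping). [cite: Lang2002, Ch. IV §1] -/
theorem wtGT_rename_some {wt : Option ι → M} {ω : ι → M} (hcomp : wt ∘ some = ω) {f : MvPolynomial ι K} {n : M}
    (hf : LeadingForm.WtGT ω n f) : LeadingForm.WtGT wt n (rename some f) := by
  classical
  intro d hd
  rw [support_rename_of_injective (Option.some_injective ι)] at hd
  obtain ⟨m, hm, rfl⟩ := Finset.mem_image.mp hd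
  rw [VertexStep.weight_mapDomain, hcomp]
  exact hf m hm

omit [LinearOrder M] [IsOrderedAddMonoid M] in
/-- Weighted homogeneous components commute with `rename some` when the new weight extends the old one (ours, bookkeeping).
[cite: Lang2002, Ch. IV §1] -/
theorem weightedHomogeneousComponent_rename_some {wt : Option ι → M} {ω : ι → M} (hcomp : wt ∘ some = ω) (n : M)
    (f : MvPolynomial ι K) :
    weightedHomogeneousComponent wt n (rename some f) = rename some (weightedHomogeneousComponent ω n f) := by
  classical
  conv_lhs => rw [f.as_sum, map_sum, map_sum]
  conv_rhs => rw [f.as_sum, map_sum, map_sum]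
  refine Finset.sum_congr rfl fun m _ => ?_
  have h1 : IsWeightedHomogeneous wt (rename some (monomial m (coeff m f)) : MvPolynomial (Option ι) K)
      (Finsupp.weight ω m) :=
    isWeightedHomogeneous_rename_some hcomp (isWeightedHomogeneous_monomial ω m _ rfl)
  have h2 : IsWeightedHomogeneous ω (monomial m (coeff m f)) (Finsupp.weight ω m) :=
    isWeightedHomogeneous_monomial ω m _ rfl
  by_cases hn : n = Finsupp.weight ω m
  · rw [hn, h1.weightedHomogeneousComponent_same, h2.weightedHomogeneousComponent_same]
  · rw [h1.weightedHomogeneousComponent_ne n hn, h2.weightedHomogeneousComponent_ne n hn, map_zero]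

omit [IsOrderedAddMonoid M] in
/-- Removing the weight-`n` component from a polynomial whose monomials weigh `≥ n` leaves only weights `> n` (ours, bookkeeping).
[cite: Lang2002, Ch. IV §1] -/
theorem wtGT_sub_weightedHomogeneousComponent {ω : ι → M} {n : M} {f : MvPolynomial ι K} (hf : LeadingForm.WtGE ω n f) :
    LeadingForm.WtGT ω n (f - weightedHomogeneousComponent ω n f) := by
  classical
  intro m hm
  have hc : coeff m (f - weightedHomogeneousComponent ω n f) ≠ 0 := mem_support_iff.mp hm
  rw [coeff_sub, coeff_weightedHomogeneousComponent] at hc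
  by_cases h : Finsupp.weight ω m = n
  · rw [if_pos h, sub_self] at hc
    exact absurd rfl hc
  · rw [if_neg h, sub_zero] at hc
    exact lt_of_le_of_ne (hf m (mem_support_iff.mpr hc)) (Ne.symm h)

/-- Non-negative weights bound every monomial below by `0` (ours, bookkeeping). [cite: Lang2002, Ch. IV §1] -/
theorem wtGE_zero_of_nonneg {ω : ι → M} (hω : ∀ j, 0 ≤ ω j) (G : MvPolynomial ι K) : LeadingForm.WtGE ω 0 G := by
  intro m _
  rw [Finsupp.weight_apply, Finsupp.sum]
  exact Finset.sum_nonneg fun i _ => nsmul_nonneg (hω i) _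

/-- With non-negative weights, a variable occurring in a weight-`0` exponent has weight `0` (ours, bookkeeping).
[cite: Lang2002, Ch. IV §1] -/
theorem weight_eq_zero_of_nonneg {ω : ι → M} (hω : ∀ j, 0 ≤ ω j) {m : ι →₀ ℕ} (hm : Finsupp.weight ω m = 0) {j : ι}
    (hj : j ∈ m.support) : ω j = 0 := by
  rw [Finsupp.weight_apply, Finsupp.sum] at hm
  have hall := (Finset.sum_eq_zero_iff_of_nonneg fun i _ => nsmul_nonneg (hω i) (m i)).mp hm j hj
  rcases (hω j).lt_or_eq with hlt | heq
  · exact absurd hall (nsmul_pos hlt (Finsupp.mem_support_iff.mp hj)).ne'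
  · exact heq.symm

/-- **LEMMA L, step 1 — the graded reduction** (ours): weigh the slots by `ω` and the parameter `t` by `−d`.  If every monomial of
`G` weighs `≥ 0`, every monomial of `v_j` weighs `≥ ω_j + d` (so that `t·v_j` weighs at least `ω_j`, the weight of `ε_j`), and the line
of translations along `v` fixes `G` (`G(ε + t·v) = G(ε)`), then the weight-`0` part `Ḡ` of `G` is fixed by the line along the LEADING
blocks `v^{lead}_j :=` the weight-`(ω_j + d)` component of `v_j`: `Ḡ(ε + t·v^{lead}) = Ḡ(ε)`.  Proof: the leading-form principle
`LeadingForm.weightedHomogeneousComponent_aeval_of_wtGE` in the `Option`-world of `WeightedCentreVertexStep`.  (Engine: `ω` = the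
`Z`-weight, `v = 0` on `Z`, `d` = the least `Z`-weight of a block, `Ḡ = G|_{ε_Z = 0}`.)
[cite: Lang2002, Ch. IV §1; Matsumura1987, §27 (p. 207)] -/
theorem polyShift_leading_eq_C [DecidableEq ι] (ω : ι → M) {G : MvPolynomial ι K} (hG : LeadingForm.WtGE ω 0 G)
    (v : ι → MvPolynomial ι K) (d : M) (hv : ∀ j, LeadingForm.WtGE ω (ω j + d) (v j))
    (h : PolyShift.polyShift v G = Polynomial.C G) :
    PolyShift.polyShift (fun j => weightedHomogeneousComponent ω (ω j + d) (v j)) (weightedHomogeneousComponent ω 0 G)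
      = Polynomial.C (weightedHomogeneousComponent ω 0 G) := by
  classical
  let wt : Option ι → M := fun o => o.elim (-d) ω
  have hcomp : (wt ∘ some) = ω := rfl
  let a : ι → MvPolynomial (Option ι) K :=
    fun j => X (some j) + X none * rename some (weightedHomogeneousComponent ω (ω j + d) (v j))
  let b : ι → MvPolynomial (Option ι) K :=
    fun j => X none * rename some (v j - weightedHomogeneousComponent ω (ω j + d) (v j))
  -- (1) `a_j` is `wt`-homogeneous of weight `ω j`
  have ha : ∀ j, IsWeightedHomogeneous wt (a j) (ω j) := by
    intro j
    refine IsWeightedHomogeneous.add (isWeightedHomogeneous_X (R := K) wt (some j)) ?_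
    have h2 : IsWeightedHomogeneous wt (rename some (weightedHomogeneousComponent ω (ω j + d) (v j))) (ω j + d) :=
      isWeightedHomogeneous_rename_some (K := K) hcomp (weightedHomogeneousComponent_isWeightedHomogeneous (ω j + d) (v j))
    have h3 := (isWeightedHomogeneous_X (R := K) wt none).mul h2
    have e : wt none + (ω j + d) = ω j := by
      show -d + (ω j + d) = ω j
      abel
    rwa [e] at h3
  -- (2) `b_j` weighs strictly more than `ω j`
  have hb : ∀ j, LeadingForm.WtGT wt (ω j) (b j) := by
    intro j
    have h1 : LeadingForm.WtGE wt (-d) (X none : MvPolynomial (Option ι) K) :=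
      LeadingForm.wtGE_of_isWeightedHomogeneous (isWeightedHomogeneous_X (R := K) wt none)
    have h2 : LeadingForm.WtGT wt (ω j + d) (rename some (v j - weightedHomogeneousComponent ω (ω j + d) (v j))) :=
      wtGT_rename_some (K := K) hcomp (wtGT_sub_weightedHomogeneousComponent (hv j))
    have h3 := h1.mul_wtGT h2
    have e : -d + (ω j + d) = ω j := by abel
    rwa [e] at h3
  -- (3) `a + b` is the family `ε_j ↦ ε_j + t·v_j`
  have hab : (fun j => a j + b j) = fun j => X (some j) + X none * rename some (v j) := by
    funext j
    simp only [a, b, map_sub]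
    ring
  -- (4) the hypothesis, read in the `Option`-world
  have hE : aeval (fun j => X (some j) + X none * rename some (v j)) G = rename some G := by
    apply (optionEquivLeft K ι).injective
    rw [VertexStep.optionEquivLeft_aeval, VertexStep.optionEquivLeft_rename_some]
    exact h
  -- (5) the leading-form principle on weight-`0` components
  have key := LeadingForm.weightedHomogeneousComponent_aeval_of_wtGE (wt := wt) (w := ω) (a := a) (b := b) (n := 0) ha hb hG
  rw [hab, hE, weightedHomogeneousComponent_rename_some (K := K) hcomp] at key
  -- `key : rename some Ḡ = aeval a Ḡ`; back through `optionEquivLeft`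
  have k2 := congrArg (optionEquivLeft K ι) key
  rw [VertexStep.optionEquivLeft_rename_some, VertexStep.optionEquivLeft_aeval] at k2
  exact k2.symm

end Reduction

/-! ## 3. The lex-leading vertex: a constant invariant direction of `Ḡ` (`K` a domain) -/

section Vertex

variable {K : Type*} [CommRing K] [Nontrivial K] [NoZeroDivisors K] {ι : Type*} [Fintype ι] [DecidableEq ι]
  {M : Type*} [AddCommGroup M] [LinearOrder M] [IsOrderedAddMonoid M]

/-- **LEMMA L, step 2 — a constant invariant direction of `Ḡ`** (ours; `K` a domain).  Slots of positive weight `ω` (the parameter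
slots `Z`) are unmoved, every block `v_j` is a polynomial in the `Z`-slots weighing `≥ d`, and the line along `v` fixes `G`.  If some
block has a non-zero weight-`d` part, then the weight-`0` part `Ḡ` of `G` (its `Z`-free part) has a NON-ZERO CONSTANT invariant direction
`θ` supported on the slots with a non-zero weight-`d` block: `θ_j :=` the coefficient of the lex-leading `Z`-exponent `γ₀` in `v_j^{(d)}`
(`exists_weight_unique_top` + `VertexStep.isInvariantDir_of_vertex` after the graded reduction `polyShift_leading_eq_C`).
[cite: Lang2002, Ch. IV §1, Ch. XIII §4; AbramovichTemkinWlodarczyk2024, §5.1 (p. 1575)] -/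
theorem exists_isInvariantDir (ω : ι → M) (hω : ∀ j, 0 ≤ ω j) {G : MvPolynomial ι K} (v : ι → MvPolynomial ι K) (d : M)
    (hvZ : ∀ j, ∀ i ∈ (v j).vars, 0 < ω i) (hv0 : ∀ j, 0 < ω j → v j = 0) (hv : ∀ j, LeadingForm.WtGE ω d (v j))
    (h : PolyShift.polyShift v G = Polynomial.C G) (hne : ∃ j, weightedHomogeneousComponent ω d (v j) ≠ 0) :
    ∃ θ : ι → K, θ ≠ 0 ∧ (∀ j, weightedHomogeneousComponent ω d (v j) = 0 → θ j = 0) ∧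
      IsInvariantDir (weightedHomogeneousComponent ω 0 G) θ := by
  classical
  have hω0 : ∀ j, ¬ 0 < ω j → ω j = 0 := fun j hj => le_antisymm (not_lt.mp hj) (hω j)
  -- step 1 applies: slots of positive weight are unmoved
  have hv' : ∀ j, LeadingForm.WtGE ω (ω j + d) (v j) := by
    intro j
    by_cases hj : 0 < ω j
    · rw [hv0 j hj]
      exact LeadingForm.wtGE_zero _
    · rw [hω0 j hj, zero_add]
      exact hv j
  have hlead : (fun j => weightedHomogeneousComponent ω (ω j + d) (v j)) = fun j => weightedHomogeneousComponent ω d (v j) := by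
    funext j
    by_cases hj : 0 < ω j
    · simp only [hv0 j hj, map_zero]
    · simp only [hω0 j hj, zero_add]
  have h₀ : PolyShift.polyShift (fun j => weightedHomogeneousComponent ω d (v j)) (weightedHomogeneousComponent ω 0 G)
      = Polynomial.C (weightedHomogeneousComponent ω 0 G) := by
    have := polyShift_leading_eq_C ω (wtGE_zero_of_nonneg hω G) v d hv' h
    rwa [hlead] at this
  -- the exponents of the weight-`d` blocks, all supported in `Z = {ω > 0}`
  let Z : Finset ι := Finset.univ.filter fun i => 0 < ω i
  let Γ : Finset (ι →₀ ℕ) := Finset.univ.biUnion fun j => (weightedHomogeneousComponent ω d (v j)).support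
  have hΓ : Γ.Nonempty := by
    obtain ⟨j, hj⟩ := hne
    obtain ⟨m, hm⟩ := ne_zero_iff.mp hj
    exact ⟨m, Finset.mem_biUnion.mpr ⟨j, Finset.mem_univ _, mem_support_iff.mpr hm⟩⟩
  have hsupp : ∀ j, ∀ m ∈ (weightedHomogeneousComponent ω d (v j)).support, m ∈ (v j).support := by
    intro j m hm
    have hc : coeff m (weightedHomogeneousComponent ω d (v j)) ≠ 0 := mem_support_iff.mp hm
    rw [coeff_weightedHomogeneousComponent] at hc
    split_ifs at hc with hw
    · exact mem_support_iff.mpr hc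
    · exact absurd rfl hc
  have hZ : ∀ γ ∈ Γ, γ.support ⊆ Z := by
    intro γ hγ i hi
    obtain ⟨j, -, hγj⟩ := Finset.mem_biUnion.mp hγ
    have hiv : i ∈ (v j).vars := (mem_vars_iff_mem_support i).mpr ⟨γ, hsupp j γ hγj, hi⟩
    exact Finset.mem_filter.mpr ⟨Finset.mem_univ _, hvZ j i hiv⟩
  obtain ⟨ω', hω'Z, γ₀, hγ₀, htop⟩ := exists_weight_unique_top Z Γ hΓ hZ
  -- the vertex step
  let θ : ι → K := fun j => coeff γ₀ (weightedHomogeneousComponent ω d (v j))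
  have hG0 : ∀ j ∈ (weightedHomogeneousComponent ω 0 G).vars, ω' j = 0 := by
    intro j hj
    obtain ⟨m, hm, hjm⟩ := (mem_vars_iff_mem_support j).mp hj
    have hc : coeff m (weightedHomogeneousComponent ω 0 G) ≠ 0 := mem_support_iff.mp hm
    rw [coeff_weightedHomogeneousComponent] at hc
    split_ifs at hc with hw
    · refine hω'Z j fun hjZ => ?_
      have h0 : ω j = 0 := weight_eq_zero_of_nonneg hω hw hjm
      have hpos : 0 < ω j := (Finset.mem_filter.mp hjZ).2
      rw [h0] at hpos
      exact lt_irrefl _ hpos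
    · exact absurd rfl hc
  have hinv : IsInvariantDir (weightedHomogeneousComponent ω 0 G) θ := by
    refine VertexStep.isInvariantDir_of_vertex ω' hG0 (fun j => weightedHomogeneousComponent ω d (v j)) θ γ₀
      (fun j _ => ?_) h₀
    intro m hm
    have hcm : coeff m (weightedHomogeneousComponent ω d (v j) - C (θ j) * monomial γ₀ 1) ≠ 0 := mem_support_iff.mp hm
    rw [coeff_sub, C_mul_monomial, mul_one, coeff_monomial] at hcm
    by_cases hmγ : γ₀ = m
    · subst hmγ
      rw [if_pos rfl, sub_self] at hcm
      exact absurd rfl hcm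
    · rw [if_neg hmγ, sub_zero] at hcm
      exact htop m (Finset.mem_biUnion.mpr ⟨j, Finset.mem_univ _, mem_support_iff.mpr hcm⟩) (Ne.symm hmγ)
  refine ⟨θ, fun hθ => ?_, fun j hj => by simp only [θ, hj, coeff_zero], hinv⟩
  obtain ⟨j, -, hj⟩ := Finset.mem_biUnion.mp hγ₀
  exact mem_support_iff.mp hj (congrFun hθ j)

end Vertex

/-! ## 4. Transfer to the face and the class-pin contradiction -/

section Face

variable {K : Type*} [CommRing K] {ι : Type*}

/-- **An invariant direction supported in the heavy slots passes to the face** (ours): if `F(ε + t·c) = F(ε)` and `c` vanishes off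
the heavy slots `H`, then the face `F|_{ε_light = 0} = killLight H F` has the same invariant direction — killing the light slots commutes
with the translation along `c`. [cite: Lang2002, Ch. IV §1; AbramovichTemkinWlodarczyk2024, §5.1 (p. 1575)] -/
theorem isInvariantDir_killLight (H : ι → Prop) [DecidablePred H] {F : MvPolynomial ι K} {c : ι → K}
    (hc : IsInvariantDir F c) (hcH : ∀ j, ¬ H j → c j = 0) :
    IsInvariantDir (killLight H F) c := by
  have hC : ∀ a : K, WeightedBlowup.killLight (S := K) H (C a) = C a := fun a => by
    simp [WeightedBlowup.killLight, MvPolynomial.algebraMap_eq]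
  have key : (lineShift c).toRingHom.comp (WeightedBlowup.killLight (S := K) H).toRingHom
      = (Polynomial.mapRingHom (WeightedBlowup.killLight (S := K) H).toRingHom).comp (lineShift c).toRingHom := by
    refine MvPolynomial.ringHom_ext (fun a => ?_) (fun i => ?_)
    · simp only [RingHom.comp_apply, AlgHom.toRingHom_eq_coe, RingHom.coe_coe, Polynomial.coe_mapRingHom, hC,
        lineShift_C, Polynomial.map_C]
    · simp only [RingHom.comp_apply, AlgHom.toRingHom_eq_coe, RingHom.coe_coe, Polynomial.coe_mapRingHom, killLight_X,
        lineShift_X, Polynomial.map_add, Polynomial.map_mul, Polynomial.map_C, Polynomial.map_X, hC]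
      by_cases hi : H i
      · simp [heavyX, hi]
      · simp [heavyX, hi, hcH i hi]
  have e := RingHom.congr_fun key F
  simp only [RingHom.comp_apply, AlgHom.toRingHom_eq_coe, RingHom.coe_coe, Polynomial.coe_mapRingHom] at e
  unfold IsInvariantDir at hc ⊢
  rw [e, hc, Polynomial.map_C]
  rfl

/-- **`G` and its weight-`0` part have the same face** when the heavy slots have weight `0` (ours, bookkeeping): a heavy monomial then
weighs `0`, so it survives in the weight-`0` component. (Engine: heavy slots `{w ≥ w_S}` are never `Z`-slots.)
[cite: Lang2002, Ch. IV §1; AbramovichTemkinWlodarczyk2024, §5.1 (p. 1575)] -/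
theorem killLight_weightedHomogeneousComponent_zero {M : Type*} [AddCommMonoid M] (H : ι → Prop) [DecidablePred H]
    (ω : ι → M) (hH : ∀ i, H i → ω i = 0) (G : MvPolynomial ι K) :
    killLight H (weightedHomogeneousComponent ω 0 G) = killLight H G := by
  classical
  ext t
  rw [coeff_killLight, coeff_killLight]
  split_ifs with ht
  · rw [coeff_weightedHomogeneousComponent, if_pos]
    rw [Finsupp.weight_apply, Finsupp.sum]
    exact Finset.sum_eq_zero fun i hi => by rw [hH i (ht i hi), smul_zero]
  · rfl

variable [Fintype ι] [DecidableEq ι] {L : Type*} [Field L]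

/-- **Pin versus invariant direction on the face** (ours): a non-zero constant invariant direction of `F` supported in a class `S` of heavy
slots contradicts class-pinning of the face `killLight H F` at any slot of `S` (`InvariantDirection.ClassPinned.not_isInvariantDir` of
`WeightedCentreClassLinearPin` after `isInvariantDir_killLight`). [cite: Lang2002, Ch. XIII §4; AbramovichTemkinWlodarczyk2024, Thm. 5.3.1] -/
theorem false_of_classPinned_of_isInvariantDir (H : ι → Prop) [DecidablePred H] (S : Finset ι) (hSH : ∀ j ∈ S, H j)
    {F : MvPolynomial ι L} {c : ι → L} (hc : IsInvariantDir F c) (hc0 : c ≠ 0) (hcS : ∀ j, j ∉ S → c j = 0)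
    {i₀ : ι} (hi₀ : i₀ ∈ S) (hPin : ClassPinned S (killLight H F) i₀) : False :=
  hPin.not_isInvariantDir hi₀ hc0 hcS (isInvariantDir_killLight H hc fun j hj => hcS j fun hjS => hj (hSH j hjS))

variable {M : Type*} [AddCommGroup M] [LinearOrder M] [IsOrderedAddMonoid M]

/-- **LEMMA L at weight `d`** (ours; engine 1, RE-DERIVATION-eng1-g41 §3.7.3): in the setting of `exists_isInvariantDir` over a field,
suppose the slots with a non-zero weight-`d` block all lie in a class `S` of heavy slots, heavy slots have `Z`-weight `0`, and the face
`G|_{≥ S} = killLight H G` is class-pinned at some slot of `S`.  Then NO block has a non-zero weight-`d` part.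
[cite: Lang2002, Ch. IV §1, Ch. XIII §4; AbramovichTemkinWlodarczyk2024, §5.1 (p. 1575), Thm. 5.3.1] -/
theorem component_eq_zero_of_classPinned (ω : ι → M) (hω : ∀ j, 0 ≤ ω j) {G : MvPolynomial ι L} (v : ι → MvPolynomial ι L)
    (d : M) (hvZ : ∀ j, ∀ i ∈ (v j).vars, 0 < ω i) (hv0 : ∀ j, 0 < ω j → v j = 0) (hv : ∀ j, LeadingForm.WtGE ω d (v j))
    (h : PolyShift.polyShift v G = Polynomial.C G)
    (S : Finset ι) (hS : ∀ j, weightedHomogeneousComponent ω d (v j) ≠ 0 → j ∈ S)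
    (H : ι → Prop) [DecidablePred H] (hSH : ∀ j ∈ S, H j) (hHω : ∀ i, H i → ω i = 0)
    {i₀ : ι} (hi₀ : i₀ ∈ S) (hPin : ClassPinned S (killLight H G) i₀) (j : ι) :
    weightedHomogeneousComponent ω d (v j) = 0 := by
  by_contra hj
  obtain ⟨θ, hθ0, hθsupp, hinv⟩ := exists_isInvariantDir ω hω v d hvZ hv0 hv h ⟨j, hj⟩
  have hθS : ∀ j, j ∉ S → θ j = 0 := fun j hjS => hθsupp j (by_contra fun hne => hjS (hS j hne))
  rw [← killLight_weightedHomogeneousComponent_zero H ω hHω G] at hPin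
  exact false_of_classPinned_of_isInvariantDir H S hSH hinv hθ0 hθS hi₀ hPin

/-- **LEMMA L** (ours; engine 1, RE-DERIVATION-eng1-g41 §3.7.3, the heart of THEOREM RZ; CARVER-NOTES-eng1-g42 T92).  Slots carry a
class label `w` (the weight) and a non-negative `Z`-weight `ω` (positive exactly on the parameter slots `Z`); `v` is a RIGID direction
field — `v = 0` on `Z`, every `v_j ∈ L[ε_Z]` `ω`-homogeneous of some weight `δ_j` — with: equal block weight ⇒ equal class
(`δ_j = δ_{j'} ⇒ w_j = w_{j'}`; engine: `δ_x = w_x − rρ₁`), every `Z`-slot lighter than every moved slot (engine: `Z` an initial segment),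
and the face above every moved slot's class class-pinned (`InvariantDirection.ClassPinned`, THEOREM F / I-rigidity).  If the line of
translations along `v` fixes `G` — `G(ε + t·v) = G(ε)`, i.e. (`WeightedCentreShiftLine`) `(v_j σ^r)_j` is a fixing shift — then `v = 0`.
Proof: take `d` the least weight of a non-zero block and apply `component_eq_zero_of_classPinned` at the class of that block.
[cite: Lang2002, Ch. IV §1, Ch. XIII §4; AbramovichTemkinWlodarczyk2024, §5.1 (p. 1575), Thm. 5.3.1] -/
theorem eq_zero_of_classPinned {W : Type*} [LinearOrder W] (w : ι → W) (ω : ι → M) (hω : ∀ j, 0 ≤ ω j)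
    {G : MvPolynomial ι L} (v : ι → MvPolynomial ι L) (δ : ι → M)
    (hvZ : ∀ j, ∀ i ∈ (v j).vars, 0 < ω i) (hv0 : ∀ j, 0 < ω j → v j = 0)
    (hhom : ∀ j, IsWeightedHomogeneous ω (v j) (δ j))
    (hclass : ∀ j j', v j ≠ 0 → v j' ≠ 0 → δ j = δ j' → w j = w j')
    (hZlt : ∀ j i, v j ≠ 0 → 0 < ω i → w i < w j)
    (hPin : ∀ j, v j ≠ 0 → ClassPinned (Finset.univ.filter fun i => w i = w j) (killLight (fun i => w j ≤ w i) G) j)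
    (h : PolyShift.polyShift v G = Polynomial.C G) : v = 0 := by
  classical
  by_contra hne
  have hmoved : (Finset.univ.filter fun j => v j ≠ 0).Nonempty := by
    obtain ⟨j, hj⟩ := Function.ne_iff.mp hne
    exact ⟨j, Finset.mem_filter.mpr ⟨Finset.mem_univ _, hj⟩⟩
  obtain ⟨j₁, hj₁, hmin⟩ := Finset.exists_min_image _ δ hmoved
  have hvj₁ : v j₁ ≠ 0 := (Finset.mem_filter.mp hj₁).2
  -- every block weighs `≥ d := δ j₁`
  have hv : ∀ j, LeadingForm.WtGE ω (δ j₁) (v j) := by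
    intro j m hm
    by_cases hj : v j = 0
    · rw [hj, support_zero] at hm
      exact absurd hm (Finset.notMem_empty m)
    · rw [hhom j (mem_support_iff.mp hm)]
      exact hmin j (Finset.mem_filter.mpr ⟨Finset.mem_univ _, hj⟩)
  -- a non-zero weight-`d` part means: a moved slot of block weight `d`, hence of the class of `j₁`
  have hS : ∀ j, weightedHomogeneousComponent ω (δ j₁) (v j) ≠ 0 → j ∈ Finset.univ.filter fun i => w i = w j₁ := by
    intro j hj
    have hvj : v j ≠ 0 := fun h0 => hj (by rw [h0, map_zero])
    have hδ : δ j = δ j₁ := by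
      by_contra hδ
      exact hj ((hhom j).weightedHomogeneousComponent_ne (δ j₁) (Ne.symm hδ))
    exact Finset.mem_filter.mpr ⟨Finset.mem_univ _, hclass j j₁ hvj hvj₁ hδ⟩
  have hHω : ∀ i, w j₁ ≤ w i → ω i = 0 := by
    intro i hi
    by_contra hω0
    exact (not_lt.mpr hi) (hZlt j₁ i hvj₁ (lt_of_le_of_ne (hω i) (Ne.symm hω0)))
  have key := component_eq_zero_of_classPinned ω hω v (δ j₁) hvZ hv0 hv h (Finset.univ.filter fun i => w i = w j₁) hS
    (fun i => w j₁ ≤ w i) (fun j hj => le_of_eq (Finset.mem_filter.mp hj).2.symm) hHω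
    (Finset.mem_filter.mpr ⟨Finset.mem_univ _, rfl⟩) (hPin j₁ hvj₁) j₁
  rw [(hhom j₁).weightedHomogeneousComponent_same] at key
  exact hvj₁ key

end Face

end LemmaL

end Literature.AlgebraicGeometry.Resolution.WeightedBlowup
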